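/-
Copyright (c) 2026 the pub-hodgecm-mathlib formalisation cell (harness21).  Prover seat hodgecm-mathlib-K2E2-p11 (g0),
Track B «K2-LIT» ∕ h413, unit «FRAME» of the line `K2_E2_ThetaExhaustionByRigidity`, file #11: payment of the socket
`K2E2ThetaExhaustionByRigidity.Capture.sig_K2E2FramePinsCoherent` — THE PINNED ADELIC AND FINITE-ADELIC FRAME
TRANSPORTS ARE COHERENT: `(ιA (1, k))_f = ιV k`.  2026-09-03.
KERNEL module: THEOREMS ONLY (no definition, no named fact, no `sorry`, no instance, no notation).
-/
import Literature.NumberTheory.Automorphic.Liu2021.ThetaLiftFromLineCoinvariantJunction   -- ★ `eq_finPart_cmAdelicFrameTransport_finAdelicToAdelic_of_coe`, `coe_finPart_cmAdelicFrameTransport_finAdelicToAdelic` (+ ★ `eq_cmAdelicFrameTransport_of_coe` transitively)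
import HarnessLib

/-!
# K2_E2 road (h413 = stmt-HodgeConjecture-24833), unit «FRAME», file #11:
# the two pinned transports of the TEL frame are coherent — `(ιA (1, k))_f = ιV k`

Cell `pub/hodgecm-mathlib` (D-0151), Track B (21-frontier RULING «PUSH BOTH» 2026-09-03, director req621∕req624,
chair K2-lead ORDER #1 §4.4, SKELETON LANDED K2E2 REQUESTS l.72395), socket module
`Summits/HodgeConjecture/HodgeConjecture/Cruxes/H413/Lines/K2_E2_ThetaExhaustionByRigidity_Capture.lean`
(planner K2E2-plan (g0)), socket **`sig_K2E2FramePinsCoherent`** (#11, size S, unit FRAME, table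
`Cruxes/H413/Lines/K2_E2_ThetaExhaustionByRigidity_Sigs.md` row 11).

THE STATEMENT.  CM field `L`, totally real `L⁺ = maximalRealSubfield L`, a hermitian matrix `H ∈ M_N(L)` and a
diagonal frame `g ∈ GL_N(L)` with `ᵗḡ H g = diag dV`.  The letter (C♯)hol ∕ node B′ ∕ the E2 witness `sig_K2E2CapHolThetaWitness`
carry two transports PINNED ONLY BY THEIR MATRIX FORMULAE: an adelic one
`ιA : U(H)(𝔸_{L⁺}) →* U(diag dV)(𝔸_{L⁺})` with `↑(ιA k) = g_𝔸⁻¹ · k · g_𝔸` (`g_𝔸 = toAdeleGL L g`, hypothesis `hιA`) and a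
finite-adelic one `ιV : U(H)(𝔸_{L⁺,f}) →* U(diag dV)(𝔸_{L⁺,f})` with `↑(ιV k) = g_f⁻¹ · k · g_f` (`g_f = toFinAdeleGL L N g`,
hypothesis `hιV`).  CLAIM: they are COHERENT — for every finite-adelic `k`, the finite part of `ιA (1, k)` is `ιV k`:
`finPart (ιA (finAdelicToAdelic k)) = ιV k`.

THE MATHEMATICS ([BorelJacquet1979, §4.1] `G(𝔸) = G_∞ × G(𝔸_f)`; [Liu2021, App. D §D.1 Steps 1–2]).  Both transports are
UNIQUE given their formulae, hence equal the canonical ones of the tree: `ιA = cmAdelicFrameTransport L N H dV g hg`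
(★ `eq_cmAdelicFrameTransport_of_coe`, `Literature/NumberTheory/Automorphic/Liu2021/ThetaLiftFromLineCharacters` §1) and
`ιV = finPart ∘ cmAdelicFrameTransport ∘ finAdelicToAdelic` (★ `eq_finPart_cmAdelicFrameTransport_finAdelicToAdelic_of_coe`,
`Literature/NumberTheory/Automorphic/Liu2021/ThetaLiftFromLineCoinvariantJunction` §0); after the two substitutions the
claim is `MonoidHom.comp_apply`, i.e. `rfl`.  Equivalently, at the level of matrices over the finite adeles: the finite
part of conjugation by the principal adele `g_𝔸 = (g_∞, g_f)` is conjugation by `g_f` (★ `coe_finPart_cmAdelicFrameTransport_finAdelicToAdelic`),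
which is the second proof `framePinsCoherent'` below (one substitution + `Subtype.ext`).

* §1 `finPart_cmAdelicFrameTransport_finAdelicToAdelic_eq_of_coe` — the canonical adelic transport read at a pinned `ιV`.
* §2 **`framePinsCoherent`** — `sig_K2E2FramePinsCoherent` TOKEN FOR TOKEN (binders pasted byte-for-byte from the socket; tie probe
  `example : type_of% @framePinsCoherent = type_of% @…K2E2ThetaExhaustionByRigidity.Capture.sig_K2E2FramePinsCoherent := rfl`
  at home once the socket module is built on stream 29: `K2/K2E2-p11/g0/Probe_K2E2FramePinsCoherent.lean`);
  `framePinsCoherent'` — the same statement by the matrix-formula route (strategy variant, kept as a cross-check).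

WHAT IS NOT HERE.  Nothing about theta lifts: this is the plumbing that lets NODE B′ (stated at the canonical transports) be
read at the pinned `ιA`, `ιV` of the E2 witness `sig_K2E2CapHolThetaWitness` (#12) and the closer `sig_K2E2CapThetaClassCapture` (#13).

HONEST LABEL: HC_CM is proved only modulo the 7 printed citations (2 remaining named inputs: hLiu418 =
stmt-HodgeConjecture-24832, h413 = stmt-HodgeConjecture-24833) until rung 0 closes; this file is a
`--supports stmt-HodgeConjecture-24833` helper (unit FRAME of the K2_E2 road) and retires nothing by itself.

## References
* [BorelJacquet1979] A. Borel, H. Jacquet, *Automorphic forms and automorphic representations*, PSPM 33.1 (1979), §4.1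
  (`G(𝔸) = G_∞ × G(𝔸_f)`, finite part of a principal adele).
* [Liu2021] Y. Liu, *Fourier–Jacobi cycles and arithmetic relative trace formula*, Camb. J. Math. 9 (2021) = arXiv:2102.11518,
  App. D §D.1 Steps 1–2 (l. 5217–5219) (the frame `g` and its transports).
* [Mok2014] C. P. Mok, Mem. AMS 235 (2015), §1 Notation p. 5 (frames of unitary groups).
-/

set_option autoImplicit false
-- the mandated namespace repeats the single-problem summit's segment (`HodgeConjecture.HodgeConjecture`)
set_option linter.dupNamespace false

noncomputable section

open NumberField IsDedekindDomain
open scoped Matrix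

namespace Summit.HodgeConjecture.HodgeConjecture.Cruxes.H413.K2E2FramePinsCoherent

open Literature.NumberTheory Literature.NumberTheory.Automorphic Literature.NumberTheory.Automorphic.UnitaryGroup
open Literature.NumberTheory.Automorphic.Liu2021

/-! ## §1  The canonical adelic transport read at a pinned finite transport -/

section Frame

variable (L : Type) [Field L] [NumberField L] [IsCMField L] (N : ℕ) (H : Matrix (Fin N) (Fin N) L) (dV : Fin N → L) (g : GL (Fin N) L)
  (hg : ((g : Matrix (Fin N) (Fin N) L).map (cmConjRingHom L))ᵀ * H * (g : Matrix (Fin N) (Fin N) L) = Matrix.diagonal dV)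

/-- **The canonical adelic frame transport is coherent with any pinned finite transport**: if `ιV : U(H)(𝔸_{L⁺,f}) →* U(diag dV)(𝔸_{L⁺,f})`
satisfies `↑(ιV k) = g_f⁻¹ · k · g_f`, then `(cmAdelicFrameTransport … (1, k))_f = ιV k` — both sides have the same matrix
`g_f⁻¹ k g_f` over the finite adeles (★ `coe_finPart_cmAdelicFrameTransport_finAdelicToAdelic`). [cite: BorelJacquet1979, §4.1] -/
theorem finPart_cmAdelicFrameTransport_finAdelicToAdelic_eq_of_coe
    (ιV : finAdelic (↥(maximalRealSubfield L)) L (IsCMField.complexConj L) N H →*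
      finAdelic (↥(maximalRealSubfield L)) L (IsCMField.complexConj L) N (Matrix.diagonal dV))
    (hιV : ∀ k, ((ιV k : finAdelic (↥(maximalRealSubfield L)) L (IsCMField.complexConj L) N (Matrix.diagonal dV)) :
          GL (Fin N) (FiniteAdeleRing (𝓞 L) L)) =
        (toFinAdeleGL L N g)⁻¹ * (k : GL (Fin N) (FiniteAdeleRing (𝓞 L) L)) * toFinAdeleGL L N g)
    (k : finAdelic (↥(maximalRealSubfield L)) L (IsCMField.complexConj L) N H) :
    finPart (↥(maximalRealSubfield L)) L (IsCMField.complexConj L) N (Matrix.diagonal dV)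
        (cmAdelicFrameTransport L N H dV g hg (finAdelicToAdelic (↥(maximalRealSubfield L)) L (IsCMField.complexConj L) N H k)) =
      ιV k :=
  Subtype.ext ((coe_finPart_cmAdelicFrameTransport_finAdelicToAdelic L N H dV g hg k).trans (hιV k).symm)

end Frame

/-! ## §2  The head -/

/-- **PAYMENT OF `sig_K2E2FramePinsCoherent`** (socket #11, unit FRAME of the K2_E2 road,
`Cruxes/H413/Lines/K2_E2_ThetaExhaustionByRigidity_Capture.lean`, TOKEN FOR TOKEN): in the TEL frame the adelic transport `ιA`
and the finite-adelic transport `ιV`, pinned by the SAME `g` through their matrix formulae `hιA`, `hιV`, are COHERENT: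
`(ιA (1, k))_f = ιV k`.  Proof: both are unique given their formulae — `ιA = cmAdelicFrameTransport …` (★ `eq_cmAdelicFrameTransport_of_coe`)
and `ιV = finPart ∘ cmAdelicFrameTransport ∘ finAdelicToAdelic` (★ `eq_finPart_cmAdelicFrameTransport_finAdelicToAdelic_of_coe`) —
and for the canonical pair the identity is `rfl` (`MonoidHom.comp_apply`).  This is the plumbing that lets NODE B′ (canonical
transports) be read at the pinned `ιA`, `ιV` of the E2 letter `sig_K2E2CapHolThetaWitness`.
[cite: BorelJacquet1979, §4.1] [cite: Liu2021, App. D §D.1 Steps 1–2 (l. 5217–5219)] [cite: Mok2014, §1 Notation p. 5] -/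
theorem framePinsCoherent :
    ∀ (L : Type) [Field L] [NumberField L] [IsCMField L] (N : ℕ) (H : Matrix (Fin N) (Fin N) L) (dV : Fin N → L) (g : GL (Fin N) L)
      (hg : ((g : Matrix (Fin N) (Fin N) L).map (cmConjRingHom L))ᵀ * H * (g : Matrix (Fin N) (Fin N) L) = Matrix.diagonal dV)
      (ιA : (adelicGroupData (↥(maximalRealSubfield L)) L (IsCMField.complexConj L) N H).Adelic →*
          ↥(UnitaryGroup.adelic (↥(maximalRealSubfield L)) L (IsCMField.complexConj L) N (Matrix.diagonal dV))),
      (∀ k, ((ιA k : ↥(UnitaryGroup.adelic (↥(maximalRealSubfield L)) L (IsCMField.complexConj L) N (Matrix.diagonal dV))) :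
            GL (Fin N) (AdeleRing (𝓞 L) L)) =
          (toAdeleGL L g)⁻¹ * adelicVal (↥(maximalRealSubfield L)) L (IsCMField.complexConj L) N H k * toAdeleGL L g) →
      ∀ (ιV : finAdelic (↥(maximalRealSubfield L)) L (IsCMField.complexConj L) N H →*
          finAdelic (↥(maximalRealSubfield L)) L (IsCMField.complexConj L) N (Matrix.diagonal dV)),
      (∀ k, ((ιV k : finAdelic (↥(maximalRealSubfield L)) L (IsCMField.complexConj L) N (Matrix.diagonal dV)) :
            GL (Fin N) (FiniteAdeleRing (𝓞 L) L)) =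
          (toFinAdeleGL L N g)⁻¹ * (k : GL (Fin N) (FiniteAdeleRing (𝓞 L) L)) * toFinAdeleGL L N g) →
      ∀ k : finAdelic (↥(maximalRealSubfield L)) L (IsCMField.complexConj L) N H,
        finPart (↥(maximalRealSubfield L)) L (IsCMField.complexConj L) N (Matrix.diagonal dV)
            (ιA (finAdelicToAdelic (↥(maximalRealSubfield L)) L (IsCMField.complexConj L) N H k)) = ιV k := by
  intro L _ _ _ N H dV g hg ιA hιA ιV hιV k
  -- both transports are determined by their matrix formulae: substitute the canonical ones
  obtain rfl := eq_cmAdelicFrameTransport_of_coe L N H dV g hg ιA hιA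
  obtain rfl := eq_finPart_cmAdelicFrameTransport_finAdelicToAdelic_of_coe L N H dV g hg ιV hιV
  -- `(finPart.comp (cmAdelicFrameTransport.comp finAdelicToAdelic)) k` unfolds to the left-hand side
  rfl

/-- **`sig_K2E2FramePinsCoherent`, second proof (matrix-formula route).**  Substitute only `ιA = cmAdelicFrameTransport …`
(★ `eq_cmAdelicFrameTransport_of_coe`) and compare matrices over `𝔸_{L,f}`: the finite part of conjugation by the principal
adele `g_𝔸` is conjugation by `g_f` (§1).  Same statement as `framePinsCoherent`; kept as an independent cross-check of the
frozen socket bytes. [cite: BorelJacquet1979, §4.1] -/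
theorem framePinsCoherent' :
    ∀ (L : Type) [Field L] [NumberField L] [IsCMField L] (N : ℕ) (H : Matrix (Fin N) (Fin N) L) (dV : Fin N → L) (g : GL (Fin N) L)
      (hg : ((g : Matrix (Fin N) (Fin N) L).map (cmConjRingHom L))ᵀ * H * (g : Matrix (Fin N) (Fin N) L) = Matrix.diagonal dV)
      (ιA : (adelicGroupData (↥(maximalRealSubfield L)) L (IsCMField.complexConj L) N H).Adelic →*
          ↥(UnitaryGroup.adelic (↥(maximalRealSubfield L)) L (IsCMField.complexConj L) N (Matrix.diagonal dV))),
      (∀ k, ((ιA k : ↥(UnitaryGroup.adelic (↥(maximalRealSubfield L)) L (IsCMField.complexConj L) N (Matrix.diagonal dV))) :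
            GL (Fin N) (AdeleRing (𝓞 L) L)) =
          (toAdeleGL L g)⁻¹ * adelicVal (↥(maximalRealSubfield L)) L (IsCMField.complexConj L) N H k * toAdeleGL L g) →
      ∀ (ιV : finAdelic (↥(maximalRealSubfield L)) L (IsCMField.complexConj L) N H →*
          finAdelic (↥(maximalRealSubfield L)) L (IsCMField.complexConj L) N (Matrix.diagonal dV)),
      (∀ k, ((ιV k : finAdelic (↥(maximalRealSubfield L)) L (IsCMField.complexConj L) N (Matrix.diagonal dV)) :
            GL (Fin N) (FiniteAdeleRing (𝓞 L) L)) =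
          (toFinAdeleGL L N g)⁻¹ * (k : GL (Fin N) (FiniteAdeleRing (𝓞 L) L)) * toFinAdeleGL L N g) →
      ∀ k : finAdelic (↥(maximalRealSubfield L)) L (IsCMField.complexConj L) N H,
        finPart (↥(maximalRealSubfield L)) L (IsCMField.complexConj L) N (Matrix.diagonal dV)
            (ιA (finAdelicToAdelic (↥(maximalRealSubfield L)) L (IsCMField.complexConj L) N H k)) = ιV k := by
  intro L _ _ _ N H dV g hg ιA hιA ιV hιV k
  obtain rfl := eq_cmAdelicFrameTransport_of_coe L N H dV g hg ιA hιA
  exact finPart_cmAdelicFrameTransport_finAdelicToAdelic_eq_of_coe L N H dV g hg ιV hιV k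

/-- the two proofs prove the same proposition (definitional tie, no content). [folklore] -/
example : type_of% @framePinsCoherent = type_of% @framePinsCoherent' := rfl

end Summit.HodgeConjecture.HodgeConjecture.Cruxes.H413.K2E2FramePinsCoherent

end
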